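import Literature.AlgebraicGeometry.ShimuraVarieties.UnitaryBallLocalBiholomorphy
import Literature.NumberTheory.Transcendental.AnalytificationMorphisms
import HarnessLib

/-!
# Level coverings of compact ball quotients are holomorphic, hence morphisms of the models

Let `D₁ : UnitaryBallUniformisationDatum 2 X₁` and `D₂ : UnitaryBallUniformisationDatum 2 X₂` be two ball
uniformizations `Γ₁\𝔹² ≅ X₁(ℂ)`, `Γ₂\𝔹² ≅ X₂(ℂ)` of smooth projective surfaces with THE SAME complex
hermitian space (`D₁.Hℂ = D₂.Hℂ`, so the same negative cone and the same ball) and `Γ₁ ≤ Γ₂` read in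
`GL₃(ℂ)` (`D₁.Γ^{τ₁} ≤ D₂.Γ^{τ₁}`) — the situation of a LEVEL COVERING `Γ₁\𝔹² → Γ₂\𝔹²`. We prove:

* `unif_eq_unif_of_level` — `unif₂` is constant on the fibres of `unif₁` (the fibres are the
  `Γᵢ·ℂˣ`-orbits, field `unif_eq_unif_iff`), so
* `exists_map_unif_eq` — there is a (unique on the image, hence everywhere: `unif₁` is onto) map
  `f : X₁(ℂ) → X₂(ℂ)` with `f (unif₁ v) = unif₂ v` on the cone, the LEVEL COVERING on complex points;
* `mdifferentiable_of_map_unif_eq` — ANY map `f : X₁(ℂ) → X₂(ℂ)` intertwining the two uniformizations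
  (`f (unif₁ v) = unif₂ v`; only `D₁.Hℂ = D₂.Hℂ` is needed here), read in Hodge models `A₁`, `A₂` (the complex
  manifolds `X₁^an`, `X₂^an`), is HOLOMORPHIC: it satisfies `f ∘ ψ₁ = ψ₂` on the ball for the uniformizations
  `ψᵢ = Dᵢ.modelUnif Aᵢ 𝔣` in a common Sylvester frame, and near any point `ψ₁` has a holomorphic local
  inverse `g` in the chart (`UnitaryBallLocalBiholomorphy.ChartInverse`), so there `f = ψ₂ ∘ g ∘ (chart)`, a
  composite of holomorphic maps (`unifHolomorphic`);
* `exists_hom_map_unif_eq` — under the record `Arapura2012_Cor_15_4_6` ("a holomorphic map between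
  nonsingular projective algebraic varieties is a morphism of varieties", applied to the two
  analytifications `Aᵢ.isAnalytification`), there is a morphism `g : X₁ ⟶ X₂` of `ℂ`-schemes with
  `g(ℂ) (unif₁ v) = unif₂ v` on the cone: the level covering is a morphism of the algebraic models.  This
  is the `f` that `UnitaryBallLevelFiniteCover.lean` / `UnitaryBallThetaClassLevelChange.lean` take as a
  hypothesis (`AlgPoints.map f (D'.unif v) = D.unif v`).

All statements are theorems, and the file declares no definitions (the record enters only as the hypothesis
of the last theorem).

References: N. Bergeron, J. Millson, C. Moeglin, Acta Math. 216 (2016), Introduction §1.1 (the tower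
of congruence ball quotients `S(Γ)`); D. Arapura, *Algebraic Geometry over the Complex Numbers*
(2012), §15.4 Cor. 15.4.6; K. Fritzsche, H. Grauert, *From Holomorphic Functions to Complex Manifolds*
(2002), Ch. I §8 (local biholomorphisms).

## Provenance

Reproduction (Literature) for the Hodge-ladder cell pub-hodgecm2 (COR-CM, stage 2), seat b10: the tree twin of the
stage-1 package module `HodgeCM/Model/LevelCovering.lean` (pub-hodgecm, seat mc-glue-1 gen 2; package md5
0ad803bbbb4d, 233 l.), whose two imports were vendored copies of the tree modules imported here; namespace
`HodgeCM.Model.LevelCovering` -> `Literature.AlgebraicGeometry.ShimuraVarieties.UnitaryBallLevelCovering`,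
with the package's auxiliary definitions `coneSec` / `levelPts` / `levelMap` / `frameTransfer` dissolved into
the existence statements `exists_map_unif_eq` / `mdifferentiable_of_map_unif_eq` (same proofs). The record `Arapura2012_Cor_15_4_6` is a tree THEOREM
(`arapura2012_cor_15_4_6_holds`, `AnalytificationMorphismsProofs.lean`); it is kept as a hypothesis here so that
this file stays on the light import cone of its two imports — consumers discharge it by name. Every declaration
is kernel-checked; no new records.
-/

noncomputable section

open Matrix Function Set Filter
open scoped Manifold Topology
open Literature.Geometry.ComplexHyperbolic
open Literature.Geometry.ComplexHyperbolic.BallModel (Ball)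
open Literature.NumberTheory.Transcendental
open Literature.AlgebraicGeometry.HodgeTheory (HodgeModel)
open Literature.AlgebraicGeometry.Motives (SchemeOver ComplexPoints AlgPoints)
open CategoryTheory

namespace Literature.AlgebraicGeometry.ShimuraVarieties.UnitaryBallLevelCovering

open Literature.AlgebraicGeometry.ShimuraVarieties UnitaryBallUniformisationDatum

variable {X₁ X₂ : SchemeOver ℂ} {D₁ : UnitaryBallUniformisationDatum 2 X₁} {D₂ : UnitaryBallUniformisationDatum 2 X₂}

/-! ### The point-level covering `unif₁ v ↦ unif₂ v` -/

/-- Same complex hermitian space, same negative cone (and the same ball).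
[cite: BergeronMillsonMoeglin2016Balls, Introduction §1.1] -/
theorem cone_eq_of_Hℂ_eq (hH : D₁.Hℂ = D₂.Hℂ) : D₁.cone = D₂.cone := by
  change negCone D₁.Hℂ = negCone D₂.Hℂ
  rw [hH]

/-- **`unif₂` is constant on the fibres of `unif₁`** for a level pair `Γ₁^{τ₁} ≤ Γ₂^{τ₁}` with the same
hermitian space: the fibres of `unifᵢ` on the cone are the `Γᵢ·ℂˣ`-orbits.
[cite: BergeronMillsonMoeglin2016Balls, Introduction §1.1] -/
theorem unif_eq_unif_of_level (hH : D₁.Hℂ = D₂.Hℂ)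
    (hΓ : D₁.Γ.map (Matrix.GeneralLinearGroup.map D₁.τ₁) ≤
      D₂.Γ.map (Matrix.GeneralLinearGroup.map D₂.τ₁))
    {v w : Fin 3 → ℂ} (hv : v ∈ D₁.cone) (hw : w ∈ D₁.cone) (h : D₁.unif v = D₁.unif w) :
    D₂.unif v = D₂.unif w := by
  obtain ⟨γ, hγ, c, hc, hγv⟩ := (D₁.unif_eq_unif_iff v hv w hw).1 h
  have hmem : Matrix.GeneralLinearGroup.map D₁.τ₁ γ ∈
      D₂.Γ.map (Matrix.GeneralLinearGroup.map D₂.τ₁) :=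
    hΓ (Subgroup.mem_map_of_mem _ hγ)
  obtain ⟨γ₂, hγ₂, hγeq⟩ := Subgroup.mem_map.1 hmem
  have hv₂ : v ∈ D₂.cone := cone_eq_of_Hℂ_eq hH ▸ hv
  have hw₂ : w ∈ D₂.cone := cone_eq_of_Hℂ_eq hH ▸ hw
  refine (D₂.unif_eq_unif_iff v hv₂ w hw₂).2 ⟨γ₂, hγ₂, c, hc, ?_⟩
  have hmat := congrArg (fun g : GL (Fin 3) ℂ ↦ (g : Matrix (Fin 3) (Fin 3) ℂ)) hγeq
  simp only [coe_generalLinearGroup_map] at hmat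
  rw [hmat]
  exact hγv

/-- **The level covering on complex points** exists: a map `f : X₁(ℂ) → X₂(ℂ)` with `f (unif₁ v) = unif₂ v`
on the cone (`P ↦ unif₂ (any cone vector over P)`; `unif₁` is onto, field `surjOn_unif`, and `unif₂` is
constant on its fibres, `unif_eq_unif_of_level`). [cite: BergeronMillsonMoeglin2016Balls, Introduction §1.1] -/
theorem exists_map_unif_eq (hH : D₁.Hℂ = D₂.Hℂ)
    (hΓ : D₁.Γ.map (Matrix.GeneralLinearGroup.map D₁.τ₁) ≤
      D₂.Γ.map (Matrix.GeneralLinearGroup.map D₂.τ₁)) :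
    ∃ f : ComplexPoints X₁ → ComplexPoints X₂, ∀ v ∈ D₁.cone, f (D₁.unif v) = D₂.unif v := by
  have hsec : ∀ P : ComplexPoints X₁, ∃ v ∈ D₁.cone, D₁.unif v = P :=
    fun P ↦ D₁.surjOn_unif (mem_univ P)
  choose s hs hsP using hsec
  exact ⟨fun P ↦ D₂.unif (s P), fun v hv ↦ unif_eq_unif_of_level hH hΓ (hs _) hv (hsP _)⟩

/-! ### The covering read in Hodge models is holomorphic -/

/-- **Any map intertwining the two uniformizations is holomorphic** (read in Hodge models `A₁`, `A₂`, i.e.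
conjugated by the homeomorphisms `Xᵢ^an ≃ₜ Xᵢ(ℂ)`). A Sylvester frame `𝔣` of `D₂` is one of `D₁` (same
complex Gram matrix), and for the uniformizations `ψᵢ = Dᵢ.modelUnif Aᵢ 𝔣` on the ball `f ∘ ψ₁ = ψ₂`; near
`x = ψ₁ z`, with `g` a holomorphic local inverse of `ψ₁` in the chart `c` at `x` (`ChartInverse`:
`c⁻¹ = ψ₁ ∘ g`), `f = ψ₂ ∘ g ∘ c`, a composite of holomorphic maps.
[cite: FritzscheGrauert2002, Ch. I §8 Cor. 8.6] [cite: BergeronMillsonMoeglin2016Balls, Introduction §1.1]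
[cite: SerreGAGA1956, §2] -/
theorem mdifferentiable_of_map_unif_eq (hH : D₁.Hℂ = D₂.Hℂ) {f : ComplexPoints X₁ → ComplexPoints X₂}
    (hf : ∀ v ∈ D₁.cone, f (D₁.unif v) = D₂.unif v) (A₁ : HodgeModel 2 X₁) (A₂ : HodgeModel 2 X₂) :
    MDifferentiable 𝓘(ℂ, A₁.model) 𝓘(ℂ, A₂.model)
      (fun x ↦ A₂.isAnalytification.homeomorph.symm (f (A₁.toComplexPoints x))) := by
  obtain ⟨𝔣⟩ := D₂.nonempty_sylvesterFrame
  -- the frame `𝔣` of `D₂` is a frame of `D₁` (same complex Gram matrix)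
  have h𝔣 : (𝔣.T : Matrix (Fin 3) (Fin 3) ℂ)ᴴ * D₁.Hℂ * (𝔣.T : Matrix (Fin 3) (Fin 3) ℂ) = BallModel.J := by
    rw [hH]; exact 𝔣.conjTranspose_mul_mul
  set Φ : A₁.carrier → A₂.carrier :=
    fun x ↦ A₂.isAnalytification.homeomorph.symm (f (A₁.toComplexPoints x)) with hΦ
  -- `Φ ∘ ψ₁ = ψ₂` on the ball
  have hΦψ : ∀ z : Ball, Φ (D₁.modelUnif A₁ ⟨𝔣.T, h𝔣⟩ z.1) = D₂.modelUnif A₂ 𝔣 z.1 := by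
    intro z
    rw [hΦ]
    dsimp only
    rw [toComplexPoints_modelUnif, ballUnifMap_apply, hf _ (D₁.coneLift _ z).2]
    rfl
  intro x
  obtain ⟨z, hz⟩ := D₁.exists_modelUnif_eq A₁ ⟨𝔣.T, h𝔣⟩ x
  obtain ⟨c⟩ := D₁.nonempty_chartInverse A₁ ⟨𝔣.T, h𝔣⟩ z
  set φ := extChartAt 𝓘(ℂ, A₁.model) x with hφ
  have hcenter : φ x ∈ c.W := by
    rw [hφ, ← hz]
    exact c.center_mem
  -- `Φ = ψ₂ ∘ g ∘ φ` near `x`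
  have key : Φ =ᶠ[𝓝 x] fun x' ↦ D₂.modelUnif A₂ 𝔣 (c.g (φ x')) := by
    have h1 : ∀ᶠ x' in 𝓝 x, x' ∈ (chartAt A₁.model x).source :=
      (chartAt A₁.model x).open_source.mem_nhds (mem_chart_source _ x)
    have h2 : ∀ᶠ x' in 𝓝 x, φ x' ∈ c.W :=
      (continuousAt_extChartAt (I := 𝓘(ℂ, A₁.model)) x).eventually (c.isOpen.mem_nhds hcenter)
    filter_upwards [h1, h2] with x' hx₁ hx₂
    have hsrc : x' ∈ φ.source := by rwa [hφ, extChartAt_source]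
    have hx' : x' = D₁.modelUnif A₁ ⟨𝔣.T, h𝔣⟩ (c.g (φ x')) := by
      rw [← c.symm_eq (φ x') hx₂, hz]
      exact (φ.left_inv hsrc).symm
    have hball : c.g (φ x') ∈ BallForms.ballSet := c.mapsTo hx₂
    calc Φ x'
        = Φ (D₁.modelUnif A₁ ⟨𝔣.T, h𝔣⟩ (⟨c.g (φ x'), hball⟩ : Ball).1) := congrArg Φ hx'
      _ = D₂.modelUnif A₂ 𝔣 (⟨c.g (φ x'), hball⟩ : Ball).1 := hΦψ _
  refine MDifferentiableAt.congr_of_eventuallyEq ?_ key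
  have hφd : MDifferentiableAt 𝓘(ℂ, A₁.model) 𝓘(ℂ, A₁.model) φ x :=
    mdifferentiableAt_extChartAt (mem_chart_source _ x)
  have hg : MDifferentiableAt 𝓘(ℂ, A₁.model) 𝓘(ℂ, Fin 2 → ℂ) c.g (φ x) :=
    mdifferentiableAt_iff_differentiableAt.2 (c.differentiableAt hcenter)
  have hψ : MDifferentiableAt 𝓘(ℂ, Fin 2 → ℂ) 𝓘(ℂ, A₂.model) (D₂.modelUnif A₂ 𝔣) (c.g (φ x)) :=
    (D₂.unifHolomorphic A₂ 𝔣).mdifferentiableAt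
      (BallForms.isOpen_ballSet.mem_nhds (c.mapsTo hcenter))
  have hcomp : MDifferentiableAt 𝓘(ℂ, A₁.model) 𝓘(ℂ, A₂.model)
      (D₂.modelUnif A₂ 𝔣 ∘ (c.g ∘ φ)) x :=
    hψ.comp x (hg.comp x hφd)
  exact hcomp

/-! ### Algebraicity: the level covering is a morphism of the models -/

/-- **The level covering is a morphism of the algebraic models** (under the record
`Arapura2012_Cor_15_4_6`: a holomorphic map between nonsingular projective varieties is a morphism):
for a level pair with the same hermitian space there is `g : X₁ ⟶ X₂` over `ℂ` with
`g(ℂ) (unif₁ v) = unif₂ v` on the cone. The Hodge models `A₁`, `A₂` (analytifications) are inputs;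
the conclusion does not mention them. [cite: Arapura2012, §15.4 Cor. 15.4.6]
[cite: BergeronMillsonMoeglin2016Balls, Introduction §1.1] -/
theorem exists_hom_map_unif_eq (hA : Arapura2012_Cor_15_4_6) (hH : D₁.Hℂ = D₂.Hℂ)
    (hΓ : D₁.Γ.map (Matrix.GeneralLinearGroup.map D₁.τ₁) ≤
      D₂.Γ.map (Matrix.GeneralLinearGroup.map D₂.τ₁))
    (A₁ : HodgeModel 2 X₁) (A₂ : HodgeModel 2 X₂) :
    ∃ g : X₁ ⟶ X₂, ∀ v ∈ D₁.cone, AlgPoints.map g (D₁.unif v) = D₂.unif v := by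
  obtain ⟨f, hf⟩ := exists_map_unif_eq hH hΓ
  obtain ⟨g, hg⟩ := hA X₁ X₂ D₁.isSmoothProjective D₂.isSmoothProjective A₁.model A₁.carrier
    A₁.toComplexPoints A₁.isAnalytification A₂.model A₂.carrier A₂.toComplexPoints
    A₂.isAnalytification _ (mdifferentiable_of_map_unif_eq hH hf A₁ A₂)
  refine ⟨g, fun v hv ↦ ?_⟩
  have h := hg (A₁.isAnalytification.homeomorph.symm (D₁.unif v))
  have h₁ : A₁.toComplexPoints (A₁.isAnalytification.homeomorph.symm (D₁.unif v)) = D₁.unif v :=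
    A₁.isAnalytification.homeomorph.apply_symm_apply _
  have h₂ : A₂.toComplexPoints (A₂.isAnalytification.homeomorph.symm (f (D₁.unif v))) = f (D₁.unif v) :=
    A₂.isAnalytification.homeomorph.apply_symm_apply _
  rw [h₁, h₂, hf v hv] at h
  exact h.symm

/-- The same with the analytifications supplied by any existence statement for Hodge models (e.g. the tree's
`BettiUniverse.realHodgeModel hHD`): **for a level pair with the same hermitian space, a morphism
`g : X₁ ⟶ X₂` with `g(ℂ) ∘ unif₁ = unif₂` on the cone exists.** [cite: Arapura2012, §15.4 Cor. 15.4.6]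
[cite: BergeronMillsonMoeglin2016Balls, Introduction §1.1] -/
theorem exists_hom_map_unif_eq_of_nonempty (hA : Arapura2012_Cor_15_4_6)
    (hA₁ : Nonempty (HodgeModel 2 X₁)) (hA₂ : Nonempty (HodgeModel 2 X₂)) (hH : D₁.Hℂ = D₂.Hℂ)
    (hΓ : D₁.Γ.map (Matrix.GeneralLinearGroup.map D₁.τ₁) ≤
      D₂.Γ.map (Matrix.GeneralLinearGroup.map D₂.τ₁)) :
    ∃ g : X₁ ⟶ X₂, ∀ v ∈ D₁.cone, AlgPoints.map g (D₁.unif v) = D₂.unif v :=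
  let ⟨A₁⟩ := hA₁; let ⟨A₂⟩ := hA₂; exists_hom_map_unif_eq hA hH hΓ A₁ A₂

end Literature.AlgebraicGeometry.ShimuraVarieties.UnitaryBallLevelCovering

end
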